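import Mathlib
import HarnessLib
import Summits.SmoothPoincare4.SmoothPoincare4.Theses.SmallBranchSpheres
import Literature.Topology.FourManifolds.CircleSurgery
import Literature.Geometry.Riemannian.ChangGurskyYangProofs
import Literature.Geometry.Riemannian.EmbeddingPieceMetric

/-!
# Birth skeleton (BC3) — crux `SmallBranchSpheres.PscBranchLink` (stmt-SmoothPoincare4-13724)

Route `route-SmoothPoincare4-SmallBranchSpheres`, crux #2 `PscBranchLink` (COV-PSC): every smooth homotopy 4-sphere `M`
is a branched cover `p : M → S⁴` in SPHERE-LINK NORMAL FORM (2-knots `K i`, disjoint liftable tubes `ν i`, lifted tubes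
`σ i` with `p (σ i (x, w)) = ν i (x, w²)`, every point of `M` étale for `p` or on a `σ`-tube) such that the sphere-link
SURGERY MANIFOLD `N = (S⁴ ∖ ⋃ Kᵢ) ∪_ν ⊔ᵢ B̊³ × S¹` (an `IsOpenGluing`, pinned by `(K, ν)`) carries a Riemannian metric of
positive scalar curvature (PSC).

THE LINE ("HANDLEBODY LINE" = the route's foreseen branch (a), TWO-LAYER PLAN of the route file: ribbon sphere-links
have surgery manifold `∂(5-dimensional 2-handlebody)`, PSC by Gromov–Lawson; typed WITHOUT a ribbon / handlebody
vocabulary, which the tree lacks, by replacing "`N` bounds a 2-handlebody" with its surgery-theoretic content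
"`N` is reached from the round `S⁴` by a finite chain of ELEMENTARY CODIMENSION-≥3 MOVES" — 0-surgeries written as
connected sums with `S¹ × S³` (`Literature.Topology.FourManifolds.IsConnectedSum`), 1-surgeries as circle surgeries
(`Literature.Topology.FourManifolds.IsCircleSurgery`), and diffeomorphisms):

* `stub_handlebodyBranchLink` (T, TOPOLOGICAL, OPEN — THE LOAD-BEARING STUB): every smooth homotopy 4-sphere admits a
  sphere-link normal-form presentation `(m, K, ν, p, σ)` (verbatim the crux's clause) TOGETHER WITH a chain
  `X 0, …, X k` of closed smooth 4-manifolds, `X 0 ≅ S⁴`, each `X (j+1)` obtained from `X j` by a diffeomorphism, a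
  circle surgery or a connected sum with `S¹ × S³`, whose last member `X k` IS the surgery manifold of `(K, ν)`
  (verbatim the crux's `IsOpenGluing` clause with `P := X k`). Curvature-free. It contains branch (a): a cover of
  `S⁴` branched over a RIBBON sphere-link (Bais–Piergallini–Zuddas-type ribbon-disc extension of the unlink cover,
  arXiv:2605.26337 Thm 4.2, doubled) has `N = ∂(B⁵ ∪ 1-handles ∪ 2-handles)`, i.e. `N` = circle surgeries on
  `#ₖ S¹ × S³` = such a chain. Why it might fail: exactly the crux's own risk (Riemann–Hurwitz leaves torus
  components; removing them may force branch components whose surgery piece is not a 2-handlebody boundary —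
  e.g. fibred 2-knots with aspherical fibre), i.e. it may collapse to "Σ is a presentation sphere" or be false for an
  exotic Σ; for `M ≅ S⁴` it holds with `m = 0`, `k = 0`, `X 0 = S⁴` (so, like the crux, it is a consequence of SPC4 and
  unrefutable short of an exotic 4-sphere). Size: open-problem.
* `stub_pscCircleSurgery` (G₁, GEOMETRIC, KNOWN — Gromov–Lawson 1980 Thm A / Schoen–Yau 1979, the codimension-3 case
  in dimension 4; handle form Walsh 2011 = arXiv:0811.1245 Thm 3.1): if a closed smooth 4-manifold `X` carries a PSC
  metric and `P` is obtained from `X` by surgery on an embedded circle with trivialised normal bundle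
  (`IsCircleSurgery`, either framing), then `P` carries a PSC metric. Not in the tree (grounder g25-25/38 on
  stmt-13726: "NO Gromov–Lawson/Schoen–Yau surgery theorem … the one vendorable KNOWN ingredient for this route
  family"); a prover vendors GL Thm A as a Literature fact and derives this instance. Size L.
* `stub_pscConnectedSumCircleSphere` (G₀, GEOMETRIC, KNOWN — Gromov–Lawson 1980 / Schoen–Yau 1979, the
  codimension-4 case = 0-surgery: connected sums of PSC manifolds are PSC, and `S¹ × S³` with the product of the flat
  and the round metric has `scal = 6 > 0`): if a closed smooth 4-manifold `X` carries a PSC metric and `P` is a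
  connected sum of `X` with `S¹ × S³` (`IsConnectedSum`, Kervaire–Milnor relation, either orientation), then `P`
  carries a PSC metric. Not in the tree. Size L.
* `pscBranchLink_of_pieces : T-sig → G₁-sig → G₀-sig → (PscBranchLink unfolded)` — THE REAL COMPOSITION, sorry-free:
  take the presentation and the chain from T; prove `PSC (X j)` for all `j ≤ k` by induction on `j` — base: the round
  metric on `S⁴` (tree theorem `Literature.Geometry.Riemannian.roundSphere_four_changGurskyYang_hypotheses`,
  `scal = 12 > 0`) moved to `X 0` along the diffeomorphism (tree theorem
  `Literature.Geometry.Riemannian.exists_pscMetric_of_diffeomorph`, O'Neill Prop. 3.59); step: the three kinds of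
  move are handled by `exists_pscMetric_of_diffeomorph`, G₁ and G₀ respectively — and return `N := X k` with its
  gluing clause and the PSC metric.
* `PscBranchLink_of : PscBranchLink` — THE SKELETON THEOREM: the crux BY NAME from the three declared stubs through
  the composition (the file's only theorem whose head is the crux name; `ledger skeleton check` shape — the skeleton
  theorem may take no hypotheses other than registered obligations, so the implication lives in
  `pscBranchLink_of_pieces` and `_of` discharges it with the stubs).

`sorry` occurs ONLY in the three `stub_*` theorems.

## Disproof used

None exists: `ledger crux ls stmt-SmoothPoincare4-13724` shows no `Disproof.lean`, no dead line, no landed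
`Negative/` lemma (2026-08-17). Honoured instead: the refuter's crux-attack evidence on the item (2026-08-15,
sorry-free `Evidence.lean`/`Fixed.lean`): `SmoothPoincare4 → PscBranchLink` (witness `m = 0`, `N = S⁴`, round metric) —
the same degenerate witness inhabits stub T (`k = 0`), so T adds no falsity risk at the standard sphere; the
refuter's literature constraint "aspherical fibred 2-knot components give `N` finitely covered by `F × S¹`, no PSC"
is exactly what T's chain condition excludes (such `N` are not 2-handlebody boundaries reachable by codim-≥3 moves
from `S⁴` with PSC preserved). `ledger negatives --problem SmoothPoincare4`: empty for this route's statements.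

## BC3 probes

For each stub `S`: `S → PscBranchLink` and `S → SmoothPoincare4` by `first | exact? | simpa | aesop` (files
`bc/probe_*.lean` in the registrar's folder, importing the route file but NOT this file) — all must FAIL; results in
the registrar's NOTES.md and the evidence note.

## References

* M. Gromov, H. B. Lawson, *The classification of simply connected manifolds of positive scalar curvature*, Ann. of
  Math. 111 (1980), Thm A (surgery in codimension ≥ 3; connected sums). [GromovLawson1980]
* R. Schoen, S.-T. Yau, *On the structure of manifolds with positive scalar curvature*, Manuscripta Math. 28 (1979).
  [SchoenYau1979]
* M. Walsh, *Metrics of positive scalar curvature and generalised Morse functions I*, Mem. AMS 983 (2011) =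
  arXiv:0811.1245, Thm 3.1. [Walsh2010]
* I. Bais, R. Piergallini, D. Zuddas, arXiv:2605.26337 (2026), Thm 4.2 (ribbon-disc branched extensions).
  [BaisPiergalliniZuddas2026]  M. Iori, R. Piergallini, Geom. Topol. 6 (2002) doi:10.2140/gt.2002.6.393. [IoriPiergallini2002]
* B. O'Neill, *Semi-Riemannian geometry* (1983), Prop. 3.59 (isometry invariance of curvature). [ONeill1983]
-/

-- `Summit.<Summit>.<Problem>`: single-conjunct summit, the duplicate component is mandated (CONVENTIONS §2).
set_option linter.dupNamespace false
set_option linter.unusedVariables false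

noncomputable section

namespace Summit.SmoothPoincare4.SmoothPoincare4.Cruxes.PscBranchLink.Birth

open scoped Manifold ContDiff Topology ContinuousMap
open Set Function
open Summit.SmoothPoincare4.SmoothPoincare4.Theses.SmallBranchSpheres

/-! ## The three registered stubs

Vocabulary (all inline; Mathlib + `Literature` only): `S⁴ := Metric.sphere (0 : EuclideanSpace ℝ (Fin 5)) 1` (charts
`𝓡 4`), `S¹ := Metric.sphere (0 : EuclideanSpace ℝ (Fin 2)) 1`, `S³ := Metric.sphere (0 : EuclideanSpace ℝ (Fin 4)) 1`,
`S¹ × S³` with its product charts (model `(𝓡 1).prod (𝓡 3)`); "`X` is PSC" is the crux's clause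
`∃ g : PseudoRiemannianMetric (𝓡 4) ∞ (EuclideanSpace ℝ (Fin 4)) (TangentSpace (𝓡 4) : X → Type _), ∃ _ : g.HasLeviCivita, g.IsRiemannian ∧ ∀ x, 0 < g.scalarCurvature x`;
an "elementary codimension-≥3 move `X ⇝ P`" is
`Nonempty (X ≃ₘ⟮𝓡 4, 𝓡 4⟯ P) ∨ (∃ c : S¹ → X, IsCircleSurgery (𝓡 4) (𝓡 4) X P c) ∨ IsConnectedSum (𝓡 4) (𝓡 4) ((𝓡 1).prod (𝓡 3)) X (S¹ × S³) P`. -/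

/-- **Stub T `stub_handlebodyBranchLink` — SPHERE-LINK PRESENTATIONS WITH HANDLEBODY SURGERY MANIFOLD (the load-bearing,
open stub).** Every smooth homotopy 4-sphere `M` (summit binder) admits a branched-cover presentation `p : M → S⁴` in
sphere-link normal form `(m, K, ν, p, σ)` — verbatim the crux's normal-form clause — together with a finite chain
`X 0, …, X k` of closed smooth 4-manifolds with `X 0 ≅ S⁴`, each `X (j+1)` obtained from `X j` by a diffeomorphism, a
circle surgery (`IsCircleSurgery`, either framing) or a connected sum with `S¹ × S³` (`IsConnectedSum`), such that the
last member `X k` is the sphere-link surgery manifold of `(K, ν)` — verbatim the crux's `IsOpenGluing` clause with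
`P := X k`. Informally: `Σ` branches over a sphere-link whose surgery manifold is the boundary of a 5-dimensional
2-handlebody (ribbon sphere-links are the model case). Curvature-free; open (for `M ≅ S⁴`: `m = 0`, `k = 0`).
[arXiv:2605.26337, Thm 4.2] [doi:10.2140/gt.2002.6.393] [arXiv:1602.07459] [Kirby1997, Problem 4.113] -/
theorem stub_handlebodyBranchLink :
    ∀ (M : Type) [TopologicalSpace M] [T2Space M] [SecondCountableTopology M] [ChartedSpace (EuclideanSpace ℝ (Fin 4)) M] [IsManifold (𝓡 4) ∞ M], M ≃ₕ Metric.sphere (0 : EuclideanSpace ℝ (Fin 5)) 1 → ∃ (m : ℕ) (K : Fin m → Literature.Topology.FourManifolds.TwoKnot) (ν : Fin m → (Metric.sphere (0 : EuclideanSpace ℝ (Fin 3)) 1) × EuclideanSpace ℝ (Fin 2) → Metric.sphere (0 : EuclideanSpace ℝ (Fin 5)) 1) (p : M → Metric.sphere (0 : EuclideanSpace ℝ (Fin 5)) 1) (σ : Fin m → (Metric.sphere (0 : EuclideanSpace ℝ (Fin 3)) 1) × EuclideanSpace ℝ (Fin 2) → M), (ContMDiff (𝓡 4) (𝓡 4)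 ∞ p
      ∧ (∀ i, Manifold.IsSmoothEmbedding ((𝓡 2).prod 𝓘(ℝ, EuclideanSpace ℝ (Fin 2))) (𝓡 4) ∞ (ν i)) ∧ (∀ i (x : Metric.sphere (0 : EuclideanSpace ℝ (Fin 3)) 1), ν i (x, 0) = (K i) x)
      ∧ (∀ i j : Fin m, i ≠ j → Disjoint (Set.range (ν i)) (Set.range (ν j))) ∧ (∀ i, Manifold.IsSmoothEmbedding ((𝓡 2).prod 𝓘(ℝ, EuclideanSpace ℝ (Fin 2))) (𝓡 4) ∞ (σ i))
      ∧ (∀ i x (w : EuclideanSpace ℝ (Fin 2)), p (σ i (x, w)) = ν i (x, (WithLp.toLp 2 ![w 0 ^ 2 - w 1 ^ 2, 2 * w 0 * w 1] : EuclideanSpace ℝ (Fin 2))))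
      ∧ (∀ y, IsLocalDiffeomorphAt (𝓡 4) (𝓡 4) ∞ p y ∨ ∃ i x w, y = σ i (x, w))) ∧ ∃ (k : ℕ) (X : ℕ → Type) (_ : ∀ j, TopologicalSpace (X j)) (_ : ∀ j, T2Space (X j)) (_ : ∀ j, SecondCountableTopology (X j)) (_ : ∀ j, CompactSpace (X j)) (_ : ∀ j, ChartedSpace (EuclideanSpace ℝ (Fin 4)) (X j)) (_ : ∀ j, IsManifold (𝓡 4) ∞ (X j)), Nonempty ((Metric.sphere (0 : EuclideanSpace ℝ (Fin 5)) 1) ≃ₘ⟮𝓡 4, 𝓡 4⟯ X 0)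
      ∧ (∀ j : ℕ, j < k → Nonempty (X j ≃ₘ⟮𝓡 4, 𝓡 4⟯ X (j + 1)) ∨ (∃ c : (Metric.sphere (0 : EuclideanSpace ℝ (Fin 2)) 1) → X j, Literature.Topology.FourManifolds.IsCircleSurgery (𝓡 4) (𝓡 4) (X j) (X (j + 1)) c)
      ∨ Literature.Topology.FourManifolds.IsConnectedSum (𝓡 4) (𝓡 4) ((𝓡 1).prod (𝓡 3)) (X j) ((Metric.sphere (0 : EuclideanSpace ℝ (Fin 2)) 1) × (Metric.sphere (0 : EuclideanSpace ℝ (Fin 4)) 1)) (X (j + 1)))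
      ∧ Literature.Topology.FourManifolds.IsOpenGluing (𝓡 4) (𝓘(ℝ, EuclideanSpace ℝ (Fin 3)).prod (𝓡 1)) (𝓡 4) (A := ↥(⟨(⋃ i, Set.range ⇑(K i))ᶜ, (isClosed_iUnion_of_finite fun i => (K i).isClosed_range).isOpen_compl⟩ : TopologicalSpace.Opens (Metric.sphere (0 : EuclideanSpace ℝ (Fin 5)) 1))) (B := ↥(⟨⋃ i : Fin m, Prod.fst ⁻¹' Metric.ball (WithLp.toLp 2 ![(3 * (i : ℕ) : ℝ), 0, 0] : EuclideanSpace ℝ (Fin 3)) 1, isOpen_iUnion fun _ => Metric.isOpen_ball.preimage continuous_fst⟩ : TopologicalSpace.Opens ((EuclideanSpace ℝ (Fin 3)) × Metric.sphere (0 : EuclideanSpace ℝ (Fin 2)) 1))) (P := X k) (fun a b => ∃ (i : Fin m) (x : Metric.sphere (0 : EuclideanSpace ℝ (Fin 3)) 1) (u : Metric.sphere (0 : EuclideanSpace ℝ (Fin 2)) 1) (t : ℝ), t ∈ Set.Ioo (0 : ℝ) 1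
      ∧ (b : (EuclideanSpace ℝ (Fin 3)) × Metric.sphere (0 : EuclideanSpace ℝ (Fin 2)) 1).1 = (WithLp.toLp 2 ![(3 * (i : ℕ) : ℝ), 0, 0] : EuclideanSpace ℝ (Fin 3)) + t • (x : EuclideanSpace ℝ (Fin 3))
      ∧ (b : (EuclideanSpace ℝ (Fin 3)) × Metric.sphere (0 : EuclideanSpace ℝ (Fin 2)) 1).2 = u ∧ (a : Metric.sphere (0 : EuclideanSpace ℝ (Fin 5)) 1) = ν i (x, t • (u : EuclideanSpace ℝ (Fin 2)))) := by
  sorry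

/-- **Stub G₁ `stub_pscCircleSurgery` — POSITIVE SCALAR CURVATURE SURVIVES CIRCLE SURGERY (Gromov–Lawson 1980 Thm A /
Schoen–Yau 1979, codimension `3` in dimension `4`; known, not in the tree).** If the closed smooth 4-manifold `X`
carries a Riemannian metric (with Levi-Civita connection) of positive scalar curvature and `P` is obtained from `X`
by surgery on an embedded circle with trivialised normal bundle (`IsCircleSurgery (𝓡 4) (𝓡 4) X P c`: `P` is the open
gluing of `X ∖ c(S¹)` with `D̊² × S²` along a tube of `c`; either framing), then `P` carries such a metric too. Why
true: the surgery has codimension `4 − 1 = 3 ≥ 3`; GL's bending/torpedo construction (Walsh's handle form) gives a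
PSC metric on the trace's upper boundary, and the metric moves to `P` along the diffeomorphism with the glued model
(`exists_pscMetric_of_diffeomorph`, `IsOpenGluing.nonempty_diffeomorph`). Size L (vendor GL Thm A as a fact).
[GromovLawson1980, Thm A] [SchoenYau1979] [arXiv:0811.1245, Thm 3.1] -/
theorem stub_pscCircleSurgery :
    ∀ (X : Type) [TopologicalSpace X] [T2Space X] [SecondCountableTopology X] [CompactSpace X] [ChartedSpace (EuclideanSpace ℝ (Fin 4)) X] [IsManifold (𝓡 4) ∞ X] (P : Type) [TopologicalSpace P] [T2Space P] [SecondCountableTopology P] [CompactSpace P] [ChartedSpace (EuclideanSpace ℝ (Fin 4)) P] [IsManifold (𝓡 4) ∞ P] (c : (Metric.sphere (0 : EuclideanSpace ℝ (Fin 2)) 1) → X), Literature.Topology.FourManifolds.IsCircleSurgery (𝓡 4) (𝓡 4) X P c → (∃ g : Literature.Geometry.Lorentzian.PseudoRiemannianMetric (𝓡 4) ∞ (EuclideanSpace ℝ (Fin 4)) (TangentSpace (𝓡 4) : X → Type _), ∃ _ : g.HasLeviCivita, g.IsRiemannian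
      ∧ ∀ x, 0 < g.scalarCurvature x) → ∃ g : Literature.Geometry.Lorentzian.PseudoRiemannianMetric (𝓡 4) ∞ (EuclideanSpace ℝ (Fin 4)) (TangentSpace (𝓡 4) : P → Type _), ∃ _ : g.HasLeviCivita, g.IsRiemannian
      ∧ ∀ x, 0 < g.scalarCurvature x := by
  sorry

/-- **Stub G₀ `stub_pscConnectedSumCircleSphere` — POSITIVE SCALAR CURVATURE SURVIVES CONNECTED SUM WITH `S¹ × S³`
(Gromov–Lawson 1980 / Schoen–Yau 1979, the codimension-`4` case = 0-surgery; known, not in the tree).** If the closed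
smooth 4-manifold `X` carries a Riemannian PSC metric and `P` is a connected sum of `X` with `S¹ × S³`
(`IsConnectedSum`, Kervaire–Milnor relation on punctured smooth discs, either orientation), then `P` carries a
Riemannian PSC metric. Why true: `S¹ × S³` with (flat) × (round) has `scal = 6 > 0`, and the connected sum of two PSC
manifolds of dimension `≥ 3` is PSC (GL: surgery on `S⁰`, codimension `4`); transport to `P` along the diffeomorphism
with the glued model. Size L. [GromovLawson1980, Thm A] [SchoenYau1979] [arXiv:0811.1245] -/
theorem stub_pscConnectedSumCircleSphere :
    ∀ (X : Type) [TopologicalSpace X] [T2Space X] [SecondCountableTopology X] [CompactSpace X] [ChartedSpace (EuclideanSpace ℝ (Fin 4)) X] [IsManifold (𝓡 4) ∞ X] (P : Type) [TopologicalSpace P] [T2Space P] [SecondCountableTopology P] [CompactSpace P] [ChartedSpace (EuclideanSpace ℝ (Fin 4)) P] [IsManifold (𝓡 4) ∞ P], Literature.Topology.FourManifolds.IsConnectedSum (𝓡 4) (𝓡 4) ((𝓡 1).prod (𝓡 3)) X ((Metric.sphere (0 : EuclideanSpace ℝ (Fin 2)) 1) × (Metric.sphere (0 : EuclideanSpace ℝ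 (Fin 4)) 1)) P → (∃ g : Literature.Geometry.Lorentzian.PseudoRiemannianMetric (𝓡 4) ∞ (EuclideanSpace ℝ (Fin 4)) (TangentSpace (𝓡 4) : X → Type _), ∃ _ : g.HasLeviCivita, g.IsRiemannian
      ∧ ∀ x, 0 < g.scalarCurvature x) → ∃ g : Literature.Geometry.Lorentzian.PseudoRiemannianMetric (𝓡 4) ∞ (EuclideanSpace ℝ (Fin 4)) (TangentSpace (𝓡 4) : P → Type _), ∃ _ : g.HasLeviCivita, g.IsRiemannian
      ∧ ∀ x, 0 < g.scalarCurvature x := by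
  sorry

/-! ## Sorry-free infrastructure -/

/-- Local notation (infrastructure and composition only; the stubs above are spelled out): the round 4-sphere. -/
local notation "𝕊⁴" => (Metric.sphere (0 : EuclideanSpace ℝ (Fin 5)) 1)
/-- Local notation: the circle `S¹ ⊂ ℝ²`. -/
local notation "𝕊¹" => (Metric.sphere (0 : EuclideanSpace ℝ (Fin 2)) 1)
/-- Local notation: the round 3-sphere. -/
local notation "𝕊³" => (Metric.sphere (0 : EuclideanSpace ℝ (Fin 4)) 1)

/-- **The round `S⁴` is PSC** in the tree's formalisation: the round metric on the unit sphere of `ℝ⁵` is a `C^∞`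
Riemannian metric with Levi-Civita connection and scalar curvature `12 > 0`
(`Literature.Geometry.Riemannian.roundSphere_four_changGurskyYang_hypotheses`, specialised to `V = ℝ⁵`; the
`Fact (finrank ℝ ℝ⁵ = 4 + 1)` instance is supplied as in Mathlib's sphere instances). [cite: Lee2018, Prop. 8.36] -/
theorem psc_sphere_four :
    ∃ g : Literature.Geometry.Lorentzian.PseudoRiemannianMetric (𝓡 4) ∞ (EuclideanSpace ℝ (Fin 4))
        (TangentSpace (𝓡 4) : 𝕊⁴ → Type _), ∃ _ : g.HasLeviCivita, g.IsRiemannian ∧ ∀ x, 0 < g.scalarCurvature x := by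
  haveI : Fact (Module.finrank ℝ (EuclideanSpace ℝ (Fin 5)) = 4 + 1) := ⟨finrank_euclideanSpace_fin⟩
  obtain ⟨g, hLC, hR, hS, -⟩ :=
    Literature.Geometry.Riemannian.roundSphere_four_changGurskyYang_hypotheses (EuclideanSpace ℝ (Fin 5))
  exact ⟨g, hLC, hR, hS⟩

/-- **PSC propagates along a chain of elementary codimension-≥3 moves** starting at a manifold diffeomorphic to `S⁴`,
GIVEN the two Gromov–Lawson statements G₁ (circle surgery) and G₀ (connected sum with `S¹ × S³`) as hypotheses:
induction on the position `j ≤ k` in the chain; diffeomorphism moves by `exists_pscMetric_of_diffeomorph`. [folklore] -/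
theorem psc_along_chain
    (hG₁ : ∀ (X : Type) [TopologicalSpace X] [T2Space X] [SecondCountableTopology X] [CompactSpace X] [ChartedSpace (EuclideanSpace ℝ (Fin 4)) X] [IsManifold (𝓡 4) ∞ X] (P : Type) [TopologicalSpace P] [T2Space P] [SecondCountableTopology P] [CompactSpace P] [ChartedSpace (EuclideanSpace ℝ (Fin 4)) P] [IsManifold (𝓡 4) ∞ P] (c : (Metric.sphere (0 : EuclideanSpace ℝ (Fin 2)) 1) → X), Literature.Topology.FourManifolds.IsCircleSurgery (𝓡 4) (𝓡 4) X P c → (∃ g : Literature.Geometry.Lorentzian.PseudoRiemannianMetric (𝓡 4) ∞ (EuclideanSpace ℝ (Fin 4)) (TangentSpace (𝓡 4) : X → Type _), ∃ _ : g.HasLeviCivita, g.IsRiemannian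
      ∧ ∀ x, 0 < g.scalarCurvature x) → ∃ g : Literature.Geometry.Lorentzian.PseudoRiemannianMetric (𝓡 4) ∞ (EuclideanSpace ℝ (Fin 4)) (TangentSpace (𝓡 4) : P → Type _), ∃ _ : g.HasLeviCivita, g.IsRiemannian
      ∧ ∀ x, 0 < g.scalarCurvature x)
    (hG₀ : ∀ (X : Type) [TopologicalSpace X] [T2Space X] [SecondCountableTopology X] [CompactSpace X] [ChartedSpace (EuclideanSpace ℝ (Fin 4)) X] [IsManifold (𝓡 4) ∞ X] (P : Type) [TopologicalSpace P] [T2Space P] [SecondCountableTopology P] [CompactSpace P] [ChartedSpace (EuclideanSpace ℝ (Fin 4)) P] [IsManifold (𝓡 4) ∞ P], Literature.Topology.FourManifolds.IsConnectedSum (𝓡 4) (𝓡 4) ((𝓡 1).prod (𝓡 3)) X ((Metric.sphere (0 : EuclideanSpace ℝ (Fin 2)) 1) × (Metric.sphere (0 : EuclideanSpace ℝ (Fin 4)) 1)) P → (∃ g : Literature.Geometry.Lorentzian.PseudoRiemannianMetric (𝓡 4) ∞ (EuclideanSpace ℝ (Fin 4)) (TangentSpace (𝓡 4) : X → Type _),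 ∃ _ : g.HasLeviCivita, g.IsRiemannian
      ∧ ∀ x, 0 < g.scalarCurvature x) → ∃ g : Literature.Geometry.Lorentzian.PseudoRiemannianMetric (𝓡 4) ∞ (EuclideanSpace ℝ (Fin 4)) (TangentSpace (𝓡 4) : P → Type _), ∃ _ : g.HasLeviCivita, g.IsRiemannian
      ∧ ∀ x, 0 < g.scalarCurvature x)
    (k : ℕ) (X : ℕ → Type) [∀ j, TopologicalSpace (X j)] [∀ j, T2Space (X j)] [∀ j, SecondCountableTopology (X j)]
    [∀ j, CompactSpace (X j)] [∀ j, ChartedSpace (EuclideanSpace ℝ (Fin 4)) (X j)] [∀ j, IsManifold (𝓡 4) ∞ (X j)]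
    (h0 : Nonempty (𝕊⁴ ≃ₘ⟮𝓡 4, 𝓡 4⟯ X 0))
    (hstep : ∀ j : ℕ, j < k → Nonempty (X j ≃ₘ⟮𝓡 4, 𝓡 4⟯ X (j + 1)) ∨ (∃ c : (Metric.sphere (0 : EuclideanSpace ℝ (Fin 2)) 1) → X j, Literature.Topology.FourManifolds.IsCircleSurgery (𝓡 4) (𝓡 4) (X j) (X (j + 1)) c) ∨ Literature.Topology.FourManifolds.IsConnectedSum (𝓡 4) (𝓡 4) ((𝓡 1).prod (𝓡 3)) (X j) ((Metric.sphere (0 : EuclideanSpace ℝ (Fin 2)) 1) × (Metric.sphere (0 : EuclideanSpace ℝ (Fin 4)) 1)) (X (j + 1))) :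
    ∀ j : ℕ, j ≤ k → ∃ g : Literature.Geometry.Lorentzian.PseudoRiemannianMetric (𝓡 4) ∞ (EuclideanSpace ℝ (Fin 4)) (TangentSpace (𝓡 4) : X j → Type _), ∃ _ : g.HasLeviCivita, g.IsRiemannian ∧ ∀ x, 0 < g.scalarCurvature x := by
  intro j
  induction j with
  | zero =>
    intro _
    obtain ⟨e⟩ := h0
    obtain ⟨g, hLC, hR, hS⟩ := psc_sphere_four
    haveI := hLC
    exact Literature.Geometry.Riemannian.exists_pscMetric_of_diffeomorph e g hR hS
  | succ j ih =>
    intro hj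
    have hjk : j < k := Nat.lt_of_succ_le hj
    obtain ⟨g, hLC, hR, hS⟩ := ih (Nat.le_of_lt hjk)
    haveI := hLC
    rcases hstep j hjk with he | ⟨c, hc⟩ | hsum
    · obtain ⟨e⟩ := he
      exact Literature.Geometry.Riemannian.exists_pscMetric_of_diffeomorph e g hR hS
    · exact hG₁ (X j) (X (j + 1)) c hc ⟨g, hLC, hR, hS⟩
    · exact hG₀ (X j) (X (j + 1)) hsum ⟨g, hLC, hR, hS⟩

/-! ## The composition: the three stubs prove COV-PSC -/

/-- **Composition with explicit hypotheses** (`T-sig → G₁-sig → G₀-sig → PscBranchLink`, the conclusion written as the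
crux's one-step unfolding so that `PscBranchLink_of` below is the file's only theorem whose head is the crux name).
Proof: T gives the presentation `(m, K, ν, p, σ)`, the chain `X` and the gluing clause for `X k`; `psc_along_chain`
gives a PSC metric on `X k`; return `N := X k`. Sorry-free, standard axioms. [folklore] -/
theorem pscBranchLink_of_pieces
    (hT : ∀ (M : Type) [TopologicalSpace M] [T2Space M] [SecondCountableTopology M] [ChartedSpace (EuclideanSpace ℝ (Fin 4)) M] [IsManifold (𝓡 4) ∞ M], M ≃ₕ Metric.sphere (0 : EuclideanSpace ℝ (Fin 5)) 1 → ∃ (m : ℕ) (K : Fin m → Literature.Topology.FourManifolds.TwoKnot) (ν : Fin m → (Metric.sphere (0 : EuclideanSpace ℝ (Fin 3)) 1) × EuclideanSpace ℝ (Fin 2) → Metric.sphere (0 : EuclideanSpace ℝ (Fin 5)) 1) (p : M → Metric.sphere (0 : EuclideanSpace ℝ (Fin 5)) 1) (σ : Fin m → (Metric.sphere (0 : EuclideanSpace ℝ (Fin 3)) 1) × EuclideanSpace ℝ (Fin 2) → M), (ContMDiff (𝓡 4) (𝓡 4) ∞ p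
      ∧ (∀ i, Manifold.IsSmoothEmbedding ((𝓡 2).prod 𝓘(ℝ, EuclideanSpace ℝ (Fin 2))) (𝓡 4) ∞ (ν i)) ∧ (∀ i (x : Metric.sphere (0 : EuclideanSpace ℝ (Fin 3)) 1), ν i (x, 0) = (K i) x)
      ∧ (∀ i j : Fin m, i ≠ j → Disjoint (Set.range (ν i)) (Set.range (ν j))) ∧ (∀ i, Manifold.IsSmoothEmbedding ((𝓡 2).prod 𝓘(ℝ, EuclideanSpace ℝ (Fin 2))) (𝓡 4) ∞ (σ i))
      ∧ (∀ i x (w : EuclideanSpace ℝ (Fin 2)), p (σ i (x, w)) = ν i (x, (WithLp.toLp 2 ![w 0 ^ 2 - w 1 ^ 2, 2 * w 0 * w 1] : EuclideanSpace ℝ (Fin 2))))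
      ∧ (∀ y, IsLocalDiffeomorphAt (𝓡 4) (𝓡 4) ∞ p y ∨ ∃ i x w, y = σ i (x, w))) ∧ ∃ (k : ℕ) (X : ℕ → Type) (_ : ∀ j, TopologicalSpace (X j)) (_ : ∀ j, T2Space (X j)) (_ : ∀ j, SecondCountableTopology (X j)) (_ : ∀ j, CompactSpace (X j)) (_ : ∀ j, ChartedSpace (EuclideanSpace ℝ (Fin 4)) (X j)) (_ : ∀ j, IsManifold (𝓡 4) ∞ (X j)), Nonempty ((Metric.sphere (0 : EuclideanSpace ℝ (Fin 5)) 1) ≃ₘ⟮𝓡 4, 𝓡 4⟯ X 0)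
      ∧ (∀ j : ℕ, j < k → Nonempty (X j ≃ₘ⟮𝓡 4, 𝓡 4⟯ X (j + 1)) ∨ (∃ c : (Metric.sphere (0 : EuclideanSpace ℝ (Fin 2)) 1) → X j, Literature.Topology.FourManifolds.IsCircleSurgery (𝓡 4) (𝓡 4) (X j) (X (j + 1)) c)
      ∨ Literature.Topology.FourManifolds.IsConnectedSum (𝓡 4) (𝓡 4) ((𝓡 1).prod (𝓡 3)) (X j) ((Metric.sphere (0 : EuclideanSpace ℝ (Fin 2)) 1) × (Metric.sphere (0 : EuclideanSpace ℝ (Fin 4)) 1)) (X (j + 1)))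
      ∧ Literature.Topology.FourManifolds.IsOpenGluing (𝓡 4) (𝓘(ℝ, EuclideanSpace ℝ (Fin 3)).prod (𝓡 1)) (𝓡 4) (A := ↥(⟨(⋃ i, Set.range ⇑(K i))ᶜ, (isClosed_iUnion_of_finite fun i => (K i).isClosed_range).isOpen_compl⟩ : TopologicalSpace.Opens (Metric.sphere (0 : EuclideanSpace ℝ (Fin 5)) 1))) (B := ↥(⟨⋃ i : Fin m, Prod.fst ⁻¹' Metric.ball (WithLp.toLp 2 ![(3 * (i : ℕ) : ℝ), 0, 0] : EuclideanSpace ℝ (Fin 3)) 1, isOpen_iUnion fun _ => Metric.isOpen_ball.preimage continuous_fst⟩ : TopologicalSpace.Opens ((EuclideanSpace ℝ (Fin 3)) × Metric.sphere (0 : EuclideanSpace ℝ (Fin 2)) 1))) (P := X k) (fun a b => ∃ (i : Fin m) (x : Metric.sphere (0 : EuclideanSpace ℝ (Fin 3)) 1) (u : Metric.sphere (0 : EuclideanSpace ℝ (Fin 2)) 1) (t : ℝ), t ∈ Set.Ioo (0 : ℝ) 1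
      ∧ (b : (EuclideanSpace ℝ (Fin 3)) × Metric.sphere (0 : EuclideanSpace ℝ (Fin 2)) 1).1 = (WithLp.toLp 2 ![(3 * (i : ℕ) : ℝ), 0, 0] : EuclideanSpace ℝ (Fin 3)) + t • (x : EuclideanSpace ℝ (Fin 3))
      ∧ (b : (EuclideanSpace ℝ (Fin 3)) × Metric.sphere (0 : EuclideanSpace ℝ (Fin 2)) 1).2 = u ∧ (a : Metric.sphere (0 : EuclideanSpace ℝ (Fin 5)) 1) = ν i (x, t • (u : EuclideanSpace ℝ (Fin 2)))))
    (hG₁ : ∀ (X : Type) [TopologicalSpace X] [T2Space X] [SecondCountableTopology X] [CompactSpace X] [ChartedSpace (EuclideanSpace ℝ (Fin 4)) X] [IsManifold (𝓡 4) ∞ X] (P : Type) [TopologicalSpace P] [T2Space P] [SecondCountableTopology P] [CompactSpace P] [ChartedSpace (EuclideanSpace ℝ (Fin 4)) P] [IsManifold (𝓡 4) ∞ P] (c : (Metric.sphere (0 : EuclideanSpace ℝ (Fin 2)) 1) → X), Literature.Topology.FourManifolds.IsCircleSurgery (𝓡 4) (𝓡 4) X P c → (∃ g : Literature.Geometry.Lorentzian.PseudoRiemannianMetric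 (𝓡 4) ∞ (EuclideanSpace ℝ (Fin 4)) (TangentSpace (𝓡 4) : X → Type _), ∃ _ : g.HasLeviCivita, g.IsRiemannian
      ∧ ∀ x, 0 < g.scalarCurvature x) → ∃ g : Literature.Geometry.Lorentzian.PseudoRiemannianMetric (𝓡 4) ∞ (EuclideanSpace ℝ (Fin 4)) (TangentSpace (𝓡 4) : P → Type _), ∃ _ : g.HasLeviCivita, g.IsRiemannian
      ∧ ∀ x, 0 < g.scalarCurvature x)
    (hG₀ : ∀ (X : Type) [TopologicalSpace X] [T2Space X] [SecondCountableTopology X] [CompactSpace X] [ChartedSpace (EuclideanSpace ℝ (Fin 4)) X] [IsManifold (𝓡 4) ∞ X] (P : Type) [TopologicalSpace P] [T2Space P] [SecondCountableTopology P] [CompactSpace P] [ChartedSpace (EuclideanSpace ℝ (Fin 4)) P] [IsManifold (𝓡 4) ∞ P], Literature.Topology.FourManifolds.IsConnectedSum (𝓡 4) (𝓡 4) ((𝓡 1).prod (𝓡 3)) X ((Metric.sphere (0 : EuclideanSpace ℝ (Fin 2)) 1) × (Metric.sphere (0 : EuclideanSpace ℝ (Fin 4)) 1)) P → (∃ g :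 Literature.Geometry.Lorentzian.PseudoRiemannianMetric (𝓡 4) ∞ (EuclideanSpace ℝ (Fin 4)) (TangentSpace (𝓡 4) : X → Type _), ∃ _ : g.HasLeviCivita, g.IsRiemannian
      ∧ ∀ x, 0 < g.scalarCurvature x) → ∃ g : Literature.Geometry.Lorentzian.PseudoRiemannianMetric (𝓡 4) ∞ (EuclideanSpace ℝ (Fin 4)) (TangentSpace (𝓡 4) : P → Type _), ∃ _ : g.HasLeviCivita, g.IsRiemannian
      ∧ ∀ x, 0 < g.scalarCurvature x) :
    ∀ (M : Type) [TopologicalSpace M] [T2Space M] [SecondCountableTopology M] [ChartedSpace (EuclideanSpace ℝ (Fin 4)) M] [IsManifold (𝓡 4) ∞ M], M ≃ₕ Metric.sphere (0 : EuclideanSpace ℝ (Fin 5)) 1 → ∃ (m : ℕ) (K : Fin m → Literature.Topology.FourManifolds.TwoKnot) (ν : Fin m → (Metric.sphere (0 : EuclideanSpace ℝ (Fin 3)) 1) × EuclideanSpace ℝ (Fin 2) → Metric.sphere (0 : EuclideanSpace ℝ (Fin 5)) 1) (p : M → Metric.sphere (0 : EuclideanSpace ℝ (Fin 5)) 1) (σ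 : Fin m → (Metric.sphere (0 : EuclideanSpace ℝ (Fin 3)) 1) × EuclideanSpace ℝ (Fin 2) → M), (ContMDiff (𝓡 4) (𝓡 4) ∞ p
      ∧ (∀ i, Manifold.IsSmoothEmbedding ((𝓡 2).prod 𝓘(ℝ, EuclideanSpace ℝ (Fin 2))) (𝓡 4) ∞ (ν i)) ∧ (∀ i (x : Metric.sphere (0 : EuclideanSpace ℝ (Fin 3)) 1), ν i (x, 0) = (K i) x)
      ∧ (∀ i j : Fin m, i ≠ j → Disjoint (Set.range (ν i)) (Set.range (ν j))) ∧ (∀ i, Manifold.IsSmoothEmbedding ((𝓡 2).prod 𝓘(ℝ, EuclideanSpace ℝ (Fin 2))) (𝓡 4) ∞ (σ i))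
      ∧ (∀ i x (w : EuclideanSpace ℝ (Fin 2)), p (σ i (x, w)) = ν i (x, (WithLp.toLp 2 ![w 0 ^ 2 - w 1 ^ 2, 2 * w 0 * w 1] : EuclideanSpace ℝ (Fin 2))))
      ∧ (∀ y, IsLocalDiffeomorphAt (𝓡 4) (𝓡 4) ∞ p y ∨ ∃ i x w, y = σ i (x, w))) ∧ ∃ (N : Type) (_ : TopologicalSpace N) (_ : T2Space N) (_ : SecondCountableTopology N) (_ : CompactSpace N) (_ : ChartedSpace (EuclideanSpace ℝ (Fin 4)) N) (_ : IsManifold (𝓡 4) ∞ N), Literature.Topology.FourManifolds.IsOpenGluing (𝓡 4) (𝓘(ℝ, EuclideanSpace ℝ (Fin 3)).prod (𝓡 1)) (𝓡 4) (A := ↥(⟨(⋃ i, Set.range ⇑(K i))ᶜ, (isClosed_iUnion_of_finite fun i => (K i).isClosed_range).isOpen_compl⟩ : TopologicalSpace.Opens (Metric.sphere (0 : EuclideanSpace ℝ (Fin 5)) 1))) (B := ↥(⟨⋃ i : Fin m, Prod.fst ⁻¹' Metric.ball (WithLp.toLp 2 ![(3 * (i : ℕ) : ℝ), 0, 0] :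 EuclideanSpace ℝ (Fin 3)) 1, isOpen_iUnion fun _ => Metric.isOpen_ball.preimage continuous_fst⟩ : TopologicalSpace.Opens ((EuclideanSpace ℝ (Fin 3)) × Metric.sphere (0 : EuclideanSpace ℝ (Fin 2)) 1))) (P := N) (fun a b => ∃ (i : Fin m) (x : Metric.sphere (0 : EuclideanSpace ℝ (Fin 3)) 1) (u : Metric.sphere (0 : EuclideanSpace ℝ (Fin 2)) 1) (t : ℝ), t ∈ Set.Ioo (0 : ℝ) 1
      ∧ (b : (EuclideanSpace ℝ (Fin 3)) × Metric.sphere (0 : EuclideanSpace ℝ (Fin 2)) 1).1 = (WithLp.toLp 2 ![(3 * (i : ℕ) : ℝ), 0, 0] : EuclideanSpace ℝ (Fin 3)) + t • (x : EuclideanSpace ℝ (Fin 3))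
      ∧ (b : (EuclideanSpace ℝ (Fin 3)) × Metric.sphere (0 : EuclideanSpace ℝ (Fin 2)) 1).2 = u ∧ (a : Metric.sphere (0 : EuclideanSpace ℝ (Fin 5)) 1) = ν i (x, t • (u : EuclideanSpace ℝ (Fin 2))))
      ∧ ∃ g : Literature.Geometry.Lorentzian.PseudoRiemannianMetric (𝓡 4) ∞ (EuclideanSpace ℝ (Fin 4)) (TangentSpace (𝓡 4) : N → Type _), ∃ _ : g.HasLeviCivita, g.IsRiemannian
      ∧ ∀ x, 0 < g.scalarCurvature x := by
  intro M _ _ _ _ _ e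
  obtain ⟨m, K, ν, p, σ, hnf, k, X, iT, iH, iS, iC, iCh, iM, h0, hstep, hglue⟩ := hT M e
  obtain ⟨g, hLC, hR, hS⟩ := psc_along_chain hG₁ hG₀ k X h0 hstep k le_rfl
  exact ⟨m, K, ν, p, σ, hnf, X k, iT k, iH k, iS k, iC k, iCh k, iM k, hglue, g, hLC, hR, hS⟩

/-- **THE SKELETON THEOREM.** The crux `Summit.SmoothPoincare4.SmoothPoincare4.Theses.SmallBranchSpheres.PscBranchLink`,
concluded BY NAME from the three DECLARED stubs `stub_handlebodyBranchLink`, `stub_pscCircleSurgery`,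
`stub_pscConnectedSumCircleSphere` (the only `sorry`s of the file) through the sorry-free composition
`pscBranchLink_of_pieces`. [folklore] -/
theorem PscBranchLink_of :
    Summit.SmoothPoincare4.SmoothPoincare4.Theses.SmallBranchSpheres.PscBranchLink :=
  pscBranchLink_of_pieces stub_handlebodyBranchLink stub_pscCircleSurgery stub_pscConnectedSumCircleSphere

end Summit.SmoothPoincare4.SmoothPoincare4.Cruxes.PscBranchLink.Birth
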